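import Summits.CriticalPhenomena.PercolationContinuityZ3.Theorems.PercNearOneGluingNoHeavyLowerTailCertGeneral
import Summits.CriticalPhenomena.PercolationContinuityZ3.Theorems.PercNearOneGluingNoHeavyLowerTailCertRowsPat
import Summits.CriticalPhenomena.PercolationContinuityZ3.Theorems.PercNearOneGluingNoHeavyLowerTailCertRowsDual
import Summits.CriticalPhenomena.PercolationContinuityZ3.Theorems.PercNearOneGluingNoHeavyLowerTailCertRowsCC
import Summits.CriticalPhenomena.PercolationContinuityZ3.Theorems.PercNearOneGluingNoHeavyLowerTailCertRowsTwoSet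
import Summits.CriticalPhenomena.PercolationContinuityZ3.Theorems.PercNearOneGluingNoHeavyLowerTailCertRowsV
import Summits.CriticalPhenomena.PercolationContinuityZ3.Theorems.PercNearOneGluingNoHeavyLowerTailCertPositivity
import Summits.CriticalPhenomena.PercolationContinuityZ3.Theorems.PercNearOneGluingNoHeavyLowerTailCertEG3
import Summits.CriticalPhenomena.PercolationContinuityZ3.Theorems.PercNearOneGluingNoHeavyLowerTailPostFKG
import HarnessLib

/-!
# `NoHeavyLowerTail` (stmt-CriticalPhenomena-4575) — `COND₃`/`KN13` certificate wrapper, part 1: target formulas and typed row families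

Support file (prover prim-ineq-prove-1, new-inequality factory, prove seat; `--supports stmt-CriticalPhenomena-4575`).
Bookkeeping definitions + soundness of row families; no named facts, no sorries.

TARGET (terminals `0 = o`, `1 = a₁` (worst: `μ(a₁↮b) ≥ μ(a_j↮b)`), `2 = a₂`, `3 = a₃`, `4 = b`):
      `COND₃ :  μ({o↔A} ∩ {o↮b}) · 1  ≤  μ(o↔A) · μ(a₁↮b)`,   `{o↔A} = {o↔a₁} ∪ {o↔a₂} ∪ {o↔a₃}`
(Kozma–Nitzan's Conjecture 1 at `|A| = 3` in joint form).  A certificate is an identity of polynomials in the 52 cell masses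
      `M₀ · (μ(oA)·μ(D₁) − μ(X)·μ(⊤))  =  Σ rows λ m (E₃E₄ − E₁E₂) + Σ κ m' (μ(D₁) − μ(D_j)) + slack`   (`j = 2, 3`),
checked reflectively by `CertCheck.checkQB` (`…CertGeneral`).  This part: the fixed formulas `fOA, fX, fD, fTop, qts`; two-set exchange
rows on DNF formulas as specs (`RowSpecTS`, from `CertCells.twoSetRow`); three-petal sunflower GROUPS (`SFSpec`, rows valid IN SUM, from
`PatternSunflower.patternSunflower_three`); hypothesis×row groups (`HRBase`, `HRSpec`: `(μ(D_hi) − μ(D_lo)) · row ≥ 0` as base rows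
times the cells of `D_hi` plus reversed base rows times the cells of `D_lo`, valid in sum given the hypothesis).
Parts 2–4: `…CondCertCore` (the structure `CondCert`, checks, cell-law soundness), `…CondCertCond` (all weights, the route's
vocabulary, KN Conjecture 1 for `|A| ≤ 3` from a `COND₃` certificate), `…CondCertKN` (the same from a `KN13` certificate).
[cite: KozmaNitzan2024, Conjecture 1 (p. 3); VandenbergHaggstromKahn2005, Thm. 1.5; Gladkov2024StrongFKG, Thm. 2.1]
-/

noncomputable section

namespace Summit.CriticalPhenomena.PercolationContinuityZ3.Theorems

open MeasureTheory Set Filter Literature.Probability.Percolation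
open Literature.Probability.LatticeModels (prodBernoulli)
open scoped Classical BigOperators Topology
open PatternCells CertCheck CertCells PatternSunflower

namespace CondCert

variable {n : ℕ}

/-! ## The fixed formulas of the target -/

/-- `{o ↔ A} = {0~1} ∨ {0~2} ∨ {0~3}`. [folklore] -/
def fOA : Formula := [[(0, 1, true)], [(0, 2, true)], [(0, 3, true)]]

/-- `X = {o ↔ A} ∩ {o ↮ b}`. [folklore] -/
def fX : Formula := [[(0, 1, true), (0, 4, false)], [(0, 2, true), (0, 4, false)], [(0, 3, true), (0, 4, false)]]

/-- `D_j = {a_j ↮ b}` for a terminal index `j`. [folklore] -/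
def fD (j : Fin 5) : Formula := [[(j, 4, false)]]

/-- `⊤`. [folklore] -/
def fTop : Formula := [[]]

/-- The signed quadratic form of the target: `+ μ(oA)·μ(D₁) − μ(X)·μ(⊤)`. [folklore] -/
def qts : List QTerm := [⟨cellsOf fOA, cellsOf (fD 1), 1, true⟩, ⟨cellsOf fX, cellsOf fTop, 1, false⟩]

/-! ## Two-set formula rows as specs -/

/-- A two-set exchange row on DNF formulas (`CertCells.twoSetRow`) as a spec. [folklore] -/
structure RowSpecTS where
  /-- source set `S` -/
  S : List (Fin 5)
  /-- target set `T` -/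
  T : List (Fin 5)
  /-- `(+)`-type formulas -/
  A₁ : Formula
  /-- `(+)`-type formulas -/
  A₂ : Formula
  /-- `(−)`-type formulas -/
  B₁ : Formula
  /-- `(−)`-type formulas -/
  B₂ : Formula
  /-- monomial multiplier -/
  mult : List ℕ
  /-- weight -/
  wt : ℕ

/-- Side conditions of a two-set spec (the four syntactic type tests). [folklore] -/
def RowSpecTS.valid (r : RowSpecTS) : Bool :=
  Formula.plus r.S r.T r.A₁ && Formula.plus r.S r.T r.A₂ && Formula.plus r.T r.S r.B₁ && Formula.plus r.T r.S r.B₂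

/-- The row of a two-set spec. [folklore] -/
def RowSpecTS.toRow (r : RowSpecTS) : Row := twoSetRow r.S r.T r.A₁ r.A₂ r.B₁ r.B₂ r.mult r.wt

/-- A valid two-set spec holds at every cell law. [cite: VandenbergHaggstromKahn2005, Thm. 2.1 at q = 1] -/
theorem RowSpecTS.holds (r : RowSpecTS) (hr : r.valid = true) (w : Sym2 (Fin n) → unitInterval) (v : Fin 5 → Fin n) :
    let x : ℕ → ℝ := fun m => (prodBernoulli w).real (Cell v m)
    linEval x r.toRow.e1 * linEval x r.toRow.e2 ≤ linEval x r.toRow.e3 * linEval x r.toRow.e4 := by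
  simp only [RowSpecTS.valid, Bool.and_eq_true] at hr
  obtain ⟨⟨⟨h1, h2⟩, h3⟩, h4⟩ := hr
  exact twoSetRow_holds w v r.S r.T r.A₁ r.A₂ r.B₁ r.B₂ h1 h2 h3 h4 r.mult r.wt

/-! ## Three-petal sunflower (strong Harris–Kleitman) GROUPS of rows on pattern events -/

/-- A three-petal sunflower row on pattern tests (Aas–Gladkov / glued-AG / threshold-sunflower / lattice-clique rows of the LP lanes):
top test `φA`, petals `φ₁ φ₂ φ₃`, monomial multiplier and weight; it contributes the GROUP of two product rows
`⟨C₁, C₂ ++ C₃, A, B⟩, ⟨C₂, C₃, [], []⟩` (`B` = complement of `A ∪ C₁ ∪ C₂ ∪ C₃`), valid IN SUM. [cite: Gladkov2024StrongFKG, Cor. 4.2] -/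
structure SFSpec where
  /-- top event test -/
  φA : ℕ → Bool
  /-- first petal -/
  φ₁ : ℕ → Bool
  /-- second petal -/
  φ₂ : ℕ → Bool
  /-- third petal -/
  φ₃ : ℕ → Bool
  /-- monomial multiplier -/
  mult : List ℕ
  /-- weight -/
  wt : ℕ

/-- Side conditions of a sunflower spec (those of `PatternSunflower.patternSunflower_three`, decidable). [folklore] -/
def SFSpec.valid (s : SFSpec) : Bool :=
  MonoPat s.φA && MonoPat (fun m => s.φA m || s.φ₁ m) && MonoPat (fun m => s.φA m || s.φ₂ m) && MonoPat (fun m => s.φA m || s.φ₃ m) &&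
    DisjPat s.φ₁ s.φ₂ && DisjPat s.φ₁ s.φ₃ && DisjPat s.φ₂ s.φ₃ && DisjPat s.φA s.φ₁ && DisjPat s.φA s.φ₂ && DisjPat s.φA s.φ₃

/-- The complement test of a sunflower spec. [folklore] -/
def SFSpec.φB (s : SFSpec) : ℕ → Bool := fun m => !s.φA m && !s.φ₁ m && !s.φ₂ m && !s.φ₃ m

/-- The two product rows of a sunflower spec. [folklore] -/
def SFSpec.rows (s : SFSpec) : List Row :=
  [⟨patCells s.φ₁, patCells s.φ₂ ++ patCells s.φ₃, patCells s.φA, patCells s.φB, s.mult, s.wt⟩, ⟨patCells s.φ₂, patCells s.φ₃, [], [], s.mult, s.wt⟩]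

/-- The complement test denotes the complement of the union. [folklore] -/
theorem SFSpec.patEvent_φB (s : SFSpec) (v : Fin 5 → Fin n) :
    PatEvent v s.φB = (PatEvent v s.φA ∪ (PatEvent v s.φ₁ ∪ PatEvent v s.φ₂ ∪ PatEvent v s.φ₃))ᶜ := by
  ext ω
  obtain ⟨m, hm, hcell⟩ := exists_mem_cell v ω
  simp only [SFSpec.φB, Set.mem_compl_iff, Set.mem_union, mem_patEvent_iff v _ hm hcell, Bool.and_eq_true, Bool.not_eq_true',
    not_or, Bool.not_eq_true]
  tauto

/-- `linEval` of a concatenation. [folklore] -/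
theorem linEval_append' (x : ℕ → ℝ) (e e' : List ℕ) : linEval x (e ++ e') = linEval x e + linEval x e' := by
  simp [linEval, List.map_append, List.sum_append]

/-- **A valid sunflower spec yields rows valid IN SUM at every cell law.** [cite: Gladkov2024StrongFKG, Cor. 4.2] -/
theorem SFSpec.rowSum (s : SFSpec) (hs : s.valid = true) (w : Sym2 (Fin n) → unitInterval) (v : Fin 5 → Fin n) :
    let x : ℕ → ℝ := fun m => (prodBernoulli w).real (Cell v m)
    (s.rows.map fun r => (r.wt : ℝ) * evalM x r.mult * (linEval x r.e1 * linEval x r.e2)).sum ≤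
      (s.rows.map fun r => (r.wt : ℝ) * evalM x r.mult * (linEval x r.e3 * linEval x r.e4)).sum := by
  intro x
  have hx : ∀ i, 0 ≤ x i := fun _ => measureReal_nonneg
  simp only [SFSpec.valid, Bool.and_eq_true] at hs
  obtain ⟨⟨⟨⟨⟨⟨⟨⟨⟨hA, h1⟩, h2⟩, h3⟩, d12⟩, d13⟩, d23⟩, dA1⟩, dA2⟩, dA3⟩ := hs
  have hsf := patternSunflower_three w v s.φA s.φ₁ s.φ₂ s.φ₃ hA h1 h2 h3 d12 d13 d23 dA1 dA2 dA3
  rw [← SFSpec.patEvent_φB] at hsf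
  simp only [SFSpec.rows, List.map_cons, List.map_nil, List.sum_cons, List.sum_nil, add_zero, linEval_append']
  have e0 : linEval x ([] : List ℕ) = 0 := by simp [linEval]
  rw [e0]
  simp only [x, linEval_patCells] at *
  have hw : 0 ≤ (s.wt : ℝ) * evalM (fun m => (prodBernoulli w).real (Cell v m)) s.mult :=
    mul_nonneg (Nat.cast_nonneg _) (evalM_nonneg _ hx _)
  nlinarith [mul_le_mul_of_nonneg_left hsf hw]

/-- Rows valid in sum over a list of sunflower specs. [folklore] -/
theorem SFSpec.rowSum_all (specs : List SFSpec) (hvalid : specs.all SFSpec.valid = true) (w : Sym2 (Fin n) → unitInterval)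
    (v : Fin 5 → Fin n) :
    let x : ℕ → ℝ := fun m => (prodBernoulli w).real (Cell v m)
    ((specs.flatMap SFSpec.rows).map fun r => (r.wt : ℝ) * evalM x r.mult * (linEval x r.e1 * linEval x r.e2)).sum ≤
      ((specs.flatMap SFSpec.rows).map fun r => (r.wt : ℝ) * evalM x r.mult * (linEval x r.e3 * linEval x r.e4)).sum := by
  intro x
  induction specs with
  | nil => simp
  | cons s rest ih =>
    simp only [List.all_cons, Bool.and_eq_true] at hvalid
    rw [List.flatMap_cons, List.map_append, List.map_append, List.sum_append, List.sum_append]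
    exact add_le_add (SFSpec.rowSum s hvalid.1 w v) (ih hvalid.2)

/-! ## Hypothesis × row groups (`hyprow` columns: `(μ(D₁) − μ(D_j)) · row ≥ 0`, cubic) -/

/-- The base of a hypothesis×row column: a two-set formula row, a pattern Harris row, or a sunflower group. [folklore] -/
inductive HRBase where
  /-- two-set formula row -/
  | ts (r : RowSpecTS)
  /-- pattern Harris row -/
  | p (r : RowSpecP)
  /-- van den Berg–Kahn row -/
  | v (r : RowSpecV)
  /-- cluster-conditioned BK row -/
  | cc (r : RowSpecCC)
  /-- three-petal sunflower group -/
  | sf (s : SFSpec)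
  /-- order-dual three-petal sunflower group -/
  | dsf (s : DSFSpec)

/-- Side conditions of the base (decidable). [folklore] -/
def HRBase.valid : HRBase → Bool
  | .ts r => r.valid
  | .p r => r.valid
  | .v _ => true
  | .cc r => r.valid
  | .sf s => s.valid
  | .dsf s => s.valid

/-- The rows of the base. [folklore] -/
def HRBase.rows : HRBase → List Row
  | .ts r => [r.toRow]
  | .p r => [r.toRow]
  | .v r => [r.toRow]
  | .cc r => [r.toRow]
  | .sf s => s.rows
  | .dsf s => s.rows

/-- The base rows hold in sum at every cell law. [folklore] -/
theorem HRBase.rowSum (b : HRBase) (hb : b.valid = true) (w : Sym2 (Fin n) → unitInterval) (v : Fin 5 → Fin n) :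
    let x : ℕ → ℝ := fun m => (prodBernoulli w).real (Cell v m)
    (b.rows.map fun r => (r.wt : ℝ) * evalM x r.mult * (linEval x r.e1 * linEval x r.e2)).sum ≤
      (b.rows.map fun r => (r.wt : ℝ) * evalM x r.mult * (linEval x r.e3 * linEval x r.e4)).sum := by
  intro x
  have hx : ∀ i, 0 ≤ x i := fun _ => measureReal_nonneg
  cases b with
  | ts r =>
    simp only [HRBase.rows, List.map_cons, List.map_nil, List.sum_cons, List.sum_nil, add_zero]
    exact mul_le_mul_of_nonneg_left (RowSpecTS.holds r hb w v) (mul_nonneg (Nat.cast_nonneg _) (evalM_nonneg x hx _))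
  | p r =>
    simp only [HRBase.rows, List.map_cons, List.map_nil, List.sum_cons, List.sum_nil, add_zero]
    exact mul_le_mul_of_nonneg_left (RowSpecP.holds r hb w v) (mul_nonneg (Nat.cast_nonneg _) (evalM_nonneg x hx _))
  | v r =>
    simp only [HRBase.rows, List.map_cons, List.map_nil, List.sum_cons, List.sum_nil, add_zero]
    exact mul_le_mul_of_nonneg_left (RowSpecV.holds r w v) (mul_nonneg (Nat.cast_nonneg _) (evalM_nonneg x hx _))
  | cc r =>
    simp only [HRBase.rows, List.map_cons, List.map_nil, List.sum_cons, List.sum_nil, add_zero]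
    exact mul_le_mul_of_nonneg_left (RowSpecCC.holds r hb w v) (mul_nonneg (Nat.cast_nonneg _) (evalM_nonneg x hx _))
  | sf t => exact SFSpec.rowSum t hb w v
  | dsf t => exact DSFSpec.rowSum t hb w v

/-- A hypothesis×row group: a hypothesis `μ(D_lo) ≤ μ(D_hi)` (`hyp = (lo, hi)`, `D_j = {a_j ↮ b}`) times a base. [folklore] -/
structure HRSpec where
  /-- the hypothesis pair `(lo, hi)`: `μ(D_lo) ≤ μ(D_hi)` -/
  hyp : Fin 5 × Fin 5
  /-- the base row / group (carrying the monomial multiplier and the weight) -/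
  base : HRBase

/-- Side conditions (decidable): those of the base. [folklore] -/
def HRSpec.valid (h : HRSpec) : Bool := h.base.valid

/-- A row with one more cell in its multiplier. [folklore] -/
def rowWithCell (c : ℕ) (r : Row) : Row := ⟨r.e1, r.e2, r.e3, r.e4, c :: r.mult, r.wt⟩

/-- The reversed row. [folklore] -/
def rowRev (r : Row) : Row := ⟨r.e3, r.e4, r.e1, r.e2, r.mult, r.wt⟩

/-- The rows of a hypothesis×row group: base rows times each cell of `D₁`, reversed base rows times each cell of `D_hyp`
(valid IN SUM given the hypothesis). [folklore] -/
def HRSpec.rows (h : HRSpec) : List Row :=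
  (cellsOf (fD h.hyp.2)).flatMap (fun c => h.base.rows.map (rowWithCell c)) ++
    (cellsOf (fD h.hyp.1)).flatMap (fun c => h.base.rows.map fun r => rowWithCell c (rowRev r))

/-- `evalM` of a cons. [folklore] -/
theorem evalM_cons' (x : ℕ → ℝ) (c : ℕ) (m : List ℕ) : evalM x (c :: m) = x c * evalM x m := by
  simp [evalM]

/-- Sum over base rows with an extra cell: factor `x_c` (small side). [folklore] -/
theorem sum_rowWithCell_small (x : ℕ → ℝ) (c : ℕ) (rs : List Row) :
    ((rs.map (rowWithCell c)).map fun r => (r.wt : ℝ) * evalM x r.mult * (linEval x r.e1 * linEval x r.e2)).sum =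
      x c * (rs.map fun r => (r.wt : ℝ) * evalM x r.mult * (linEval x r.e1 * linEval x r.e2)).sum := by
  induction rs with
  | nil => simp
  | cons r t ih =>
    simp only [List.map_cons, List.sum_cons]
    rw [ih]
    simp only [rowWithCell, evalM_cons']
    ring

/-- Sum over base rows with an extra cell: factor `x_c` (large side). [folklore] -/
theorem sum_rowWithCell_large (x : ℕ → ℝ) (c : ℕ) (rs : List Row) :
    ((rs.map (rowWithCell c)).map fun r => (r.wt : ℝ) * evalM x r.mult * (linEval x r.e3 * linEval x r.e4)).sum =
      x c * (rs.map fun r => (r.wt : ℝ) * evalM x r.mult * (linEval x r.e3 * linEval x r.e4)).sum := by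
  induction rs with
  | nil => simp
  | cons r t ih =>
    simp only [List.map_cons, List.sum_cons]
    rw [ih]
    simp only [rowWithCell, evalM_cons']
    ring

/-- Reversed rows with an extra cell: the small side is `x_c ·` the large side of the base. [folklore] -/
theorem sum_rowRevWithCell_small (x : ℕ → ℝ) (c : ℕ) (rs : List Row) :
    ((rs.map fun r => rowWithCell c (rowRev r)).map fun r => (r.wt : ℝ) * evalM x r.mult * (linEval x r.e1 * linEval x r.e2)).sum =
      x c * (rs.map fun r => (r.wt : ℝ) * evalM x r.mult * (linEval x r.e3 * linEval x r.e4)).sum := by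
  induction rs with
  | nil => simp
  | cons r t ih =>
    simp only [List.map_cons, List.sum_cons]
    rw [ih]
    simp only [rowWithCell, rowRev, evalM_cons']
    ring

/-- Reversed rows with an extra cell: the large side is `x_c ·` the small side of the base. [folklore] -/
theorem sum_rowRevWithCell_large (x : ℕ → ℝ) (c : ℕ) (rs : List Row) :
    ((rs.map fun r => rowWithCell c (rowRev r)).map fun r => (r.wt : ℝ) * evalM x r.mult * (linEval x r.e3 * linEval x r.e4)).sum =
      x c * (rs.map fun r => (r.wt : ℝ) * evalM x r.mult * (linEval x r.e1 * linEval x r.e2)).sum := by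
  induction rs with
  | nil => simp
  | cons r t ih =>
    simp only [List.map_cons, List.sum_cons]
    rw [ih]
    simp only [rowWithCell, rowRev, evalM_cons']
    ring

/-- Sum of a `flatMap` as a sum of sums. [folklore] -/
theorem sum_map_flatMap' {α : Type*} (l : List α) (F : α → List Row) (g : Row → ℝ) :
    ((l.flatMap F).map g).sum = (l.map fun a => ((F a).map g).sum).sum := by
  induction l with
  | nil => simp
  | cons a t ih => simp [List.flatMap_cons, List.map_append, List.sum_append, ih]

/-- `Σ_c x_c · B = (Σ_c x_c) · B`. [folklore] -/
theorem sum_map_mul_const' (x : ℕ → ℝ) (cs : List ℕ) (B : ℝ) : (cs.map fun c => x c * B).sum = linEval x cs * B := by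
  induction cs with
  | nil => simp [linEval]
  | cons c t ih =>
    simp only [List.map_cons, List.sum_cons, linEval] at ih ⊢
    rw [ih]
    ring

/-- **A valid hypothesis×row group holds IN SUM at every cell law satisfying its hypothesis.** [folklore] -/
theorem HRSpec.rowSum (h : HRSpec) (hv : h.valid = true) (w : Sym2 (Fin n) → unitInterval) (v : Fin 5 → Fin n)
    (hh : (prodBernoulli w).real ((fD h.hyp.1).set v) ≤ (prodBernoulli w).real ((fD h.hyp.2).set v)) :
    let x : ℕ → ℝ := fun m => (prodBernoulli w).real (Cell v m)
    (h.rows.map fun r => (r.wt : ℝ) * evalM x r.mult * (linEval x r.e1 * linEval x r.e2)).sum ≤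
      (h.rows.map fun r => (r.wt : ℝ) * evalM x r.mult * (linEval x r.e3 * linEval x r.e4)).sum := by
  intro x
  have hB := HRBase.rowSum h.base hv w v
  set BS := (h.base.rows.map fun r => (r.wt : ℝ) * evalM x r.mult * (linEval x r.e1 * linEval x r.e2)).sum with hBS
  set BL := (h.base.rows.map fun r => (r.wt : ℝ) * evalM x r.mult * (linEval x r.e3 * linEval x r.e4)).sum with hBL
  have hhypx : linEval x (cellsOf (fD h.hyp.1)) ≤ linEval x (cellsOf (fD h.hyp.2)) := by
    simpa only [x, ← measureReal_set_eq_linEval] using hh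
  simp only [HRSpec.rows, List.map_append, List.sum_append, sum_map_flatMap', sum_rowWithCell_small, sum_rowWithCell_large,
    sum_rowRevWithCell_small, sum_rowRevWithCell_large, sum_map_mul_const']
  change linEval x (cellsOf (fD h.hyp.2)) * BS + linEval x (cellsOf (fD h.hyp.1)) * BL ≤
    linEval x (cellsOf (fD h.hyp.2)) * BL + linEval x (cellsOf (fD h.hyp.1)) * BS
  nlinarith [mul_le_mul_of_nonneg_left (sub_nonneg.2 hB) (sub_nonneg.2 hhypx)]

/-- Rows valid in sum over a list of hypothesis×row groups whose hypotheses hold. [folklore] -/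
theorem HRSpec.rowSum_all (specs : List HRSpec) (hvalid : specs.all HRSpec.valid = true) (w : Sym2 (Fin n) → unitInterval)
    (v : Fin 5 → Fin n)
    (hh : ∀ h ∈ specs, (prodBernoulli w).real ((fD h.hyp.1).set v) ≤ (prodBernoulli w).real ((fD h.hyp.2).set v)) :
    let x : ℕ → ℝ := fun m => (prodBernoulli w).real (Cell v m)
    ((specs.flatMap HRSpec.rows).map fun r => (r.wt : ℝ) * evalM x r.mult * (linEval x r.e1 * linEval x r.e2)).sum ≤
      ((specs.flatMap HRSpec.rows).map fun r => (r.wt : ℝ) * evalM x r.mult * (linEval x r.e3 * linEval x r.e4)).sum := by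
  intro x
  induction specs with
  | nil => simp
  | cons s rest ih =>
    simp only [List.all_cons, Bool.and_eq_true] at hvalid
    rw [List.flatMap_cons, List.map_append, List.map_append, List.sum_append, List.sum_append]
    exact add_le_add (HRSpec.rowSum s hvalid.1 w v (hh s (by simp)))
      (ih hvalid.2 fun h hm => hh h (List.mem_cons_of_mem _ hm))

end CondCert

end Summit.CriticalPhenomena.PercolationContinuityZ3.Theorems

end
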